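import Literature.Geometry.Riemannian.MetricFlowParabolicNeighborhoods
import HarnessLib

/-!
# Point picking in backward `P*`-parabolic balls (Bamler 2020a, §10.2, Claim in the proof of
# Thm. 10.2)

R. Bamler, *Entropy and heat kernel bounds on a Ricci flow background*, arXiv:2008.07093 (2020a),
§10.2, proof of Thm. 10.2 (arXiv v1 Thm. 39), Claim (arXiv v1 Claim 42): "Let `A > 0` and assume
that `10 A r_Rm(x,t) ≤ 1/2`. Then there is a point `(x', t') ∈ P*⁻(x, t; 10 A r_Rm(x,t))` such that
`r_Rm(x',t') ≤ r_Rm(x,t)` and `r_Rm ≥ r_Rm(x',t')/10` on `P*⁻(x', t'; A r_Rm(x', t'))`." Its proof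
("we can iteratively pick a maximal sequence … since `inf r_Rm > 0`, this sequence must be finite …
by induction `(x', t') ∈ P*⁻(x'ᵢ, t'ᵢ; 10 A r'ᵢ)`") uses nothing about the curvature scale except
its positive lower bound and the containment relations of `P*`-parabolic neighbourhoods
(Prop. 9.3). We prove it in that ABSTRACT form, for an arbitrary function `ρ ≥ ρ₀ > 0` on the
points of an `H`-concentrated metric flow (`MetricFlow.exists_point_picking`), so that it
applies verbatim to `ρ = r_Rm` once the curvature scale is in the tree. Everything is proved; no
definitions, no named facts.

## References

* R. H. Bamler, *Entropy and heat kernel bounds on a Ricci flow background*, arXiv:2008.07093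
  (2020), §10.2, proof of Thm. 10.2, Claim; §9.1 Prop. 9.3. [Bamler2020Entropy]
-/

noncomputable section

open Set MeasureTheory Filter TopologicalSpace
open scoped Topology ENNReal NNReal

namespace Literature.Geometry.Riemannian

universe u

namespace MetricFlow

variable {I : Set ℝ} {𝒳 : MetricFlow.{u} I}

/-- **Point picking** (Bamler 2020a, Claim in the proof of Thm. 10.2, abstract form). Let `𝒳` be
an `H`-concentrated metric flow, `ρ` a real function on its points with `ρ ≥ ρ₀ > 0`, `A > 0`, and
`x` a point such that `[𝔱(x) − 200 A² ρ(x)², 𝔱(x)] ⊆ I`. Then there is a point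
`p ∈ P*⁻(x; 10 A ρ(x))` with `ρ(p) ≤ ρ(x)` and `ρ ≥ ρ(p)/10` on `P*⁻(p; A ρ(p))`. Proof: induction
on `n` with `ρ(x) ≤ 10ⁿ ρ₀`; if the last property fails at `x`, pick `q ∈ P*⁻(x; A ρ(x))` with
`ρ(q) < ρ(x)/10`, apply the induction hypothesis at `q` and use Prop. 9.3 (c)
(`IsHConcentrated.pParabolicNhd_subset_of_mem`): `P*⁻(q; 10 A ρ(q)) ⊆ P*⁻(x; 10 A ρ(x))`.
[cite: Bamler2020Entropy, §10.2, proof of Thm. 10.2, Claim] -/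
theorem exists_point_picking {H : ℝ} (hH : 𝒳.IsHConcentrated H) (ρ : 𝒳.Pt → ℝ)
    {ρ₀ : ℝ} (hρ₀ : 0 < ρ₀) (hρ : ∀ p, ρ₀ ≤ ρ p) {A : ℝ} (hA : 0 < A) (x : 𝒳.Pt)
    (hI : Icc ((x.1 : ℝ) - 200 * A ^ 2 * ρ x ^ 2) (x.1 : ℝ) ⊆ I) :
    ∃ (p : 𝒳.Pt) (hx' : (x.1 : ℝ) - (10 * A * ρ x) ^ 2 ∈ I) (hp : (p.1 : ℝ) - (A * ρ p) ^ 2 ∈ I),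
      p ∈ 𝒳.pParabolicBallBwd x (10 * A * ρ x) hx' ∧ ρ p ≤ ρ x ∧
      ∀ q ∈ 𝒳.pParabolicBallBwd p (A * ρ p) hp, ρ p / 10 ≤ ρ q := by
  -- the claim for all `x` with `ρ x ≤ 10ⁿ ρ₀`, by induction on `n`
  suffices key : ∀ (n : ℕ) (x : 𝒳.Pt), ρ x ≤ 10 ^ n * ρ₀ →
      Icc ((x.1 : ℝ) - 200 * A ^ 2 * ρ x ^ 2) (x.1 : ℝ) ⊆ I →
      ∃ (p : 𝒳.Pt) (hx' : (x.1 : ℝ) - (10 * A * ρ x) ^ 2 ∈ I) (hp : (p.1 : ℝ) - (A * ρ p) ^ 2 ∈ I),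
        p ∈ 𝒳.pParabolicBallBwd x (10 * A * ρ x) hx' ∧ ρ p ≤ ρ x ∧
        ∀ q ∈ 𝒳.pParabolicBallBwd p (A * ρ p) hp, ρ p / 10 ≤ ρ q by
    obtain ⟨n, hn⟩ := pow_unbounded_of_one_lt (ρ x / ρ₀) (by norm_num : (1 : ℝ) < 10)
    exact key n x (by rw [div_lt_iff₀ hρ₀] at hn; exact hn.le) hI
  -- two side conditions available at every `x` with the interval hypothesis
  have hside : ∀ x : 𝒳.Pt, Icc ((x.1 : ℝ) - 200 * A ^ 2 * ρ x ^ 2) (x.1 : ℝ) ⊆ I →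
      ((x.1 : ℝ) - (10 * A * ρ x) ^ 2 ∈ I) ∧ ((x.1 : ℝ) - (A * ρ x) ^ 2 ∈ I) := by
    intro x hI
    have h0 : 0 ≤ A ^ 2 * ρ x ^ 2 := by positivity
    exact ⟨hI ⟨by nlinarith, by nlinarith⟩, hI ⟨by nlinarith, by nlinarith⟩⟩
  -- `p := x` works as soon as the maximality property holds at `x`
  have hself : ∀ x : 𝒳.Pt, Icc ((x.1 : ℝ) - 200 * A ^ 2 * ρ x ^ 2) (x.1 : ℝ) ⊆ I →
      (∀ q (hx : (x.1 : ℝ) - (A * ρ x) ^ 2 ∈ I), q ∈ 𝒳.pParabolicBallBwd x (A * ρ x) hx →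
        ρ x / 10 ≤ ρ q) →
      ∃ (p : 𝒳.Pt) (hx' : (x.1 : ℝ) - (10 * A * ρ x) ^ 2 ∈ I) (hp : (p.1 : ℝ) - (A * ρ p) ^ 2 ∈ I),
        p ∈ 𝒳.pParabolicBallBwd x (10 * A * ρ x) hx' ∧ ρ p ≤ ρ x ∧
        ∀ q ∈ 𝒳.pParabolicBallBwd p (A * ρ p) hp, ρ p / 10 ≤ ρ q := by
    intro x hI hmax
    obtain ⟨hx', hxA⟩ := hside x hI
    have hρx : 0 < ρ x := hρ₀.trans_le (hρ x)
    refine ⟨x, hx', hxA, ?_, le_rfl, fun q hq ↦ hmax q hxA hq⟩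
    exact mem_pParabolicNhd_self x (by positivity) (sq_nonneg _) le_rfl hx'
  intro n
  induction n with
  | zero =>
    intro x hx hI
    refine hself x hI fun q hxA _ ↦ ?_
    have := hρ q; have := hρ x
    simp only [pow_zero, one_mul] at hx
    linarith
  | succ n ih =>
    intro x hx hI
    by_cases hmax : ∀ q (hxA : (x.1 : ℝ) - (A * ρ x) ^ 2 ∈ I),
        q ∈ 𝒳.pParabolicBallBwd x (A * ρ x) hxA → ρ x / 10 ≤ ρ q
    · exact hself x hI hmax
    push Not at hmax
    obtain ⟨q, hxA, hq, hρq⟩ := hmax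
    have hρx : 0 < ρ x := hρ₀.trans_le (hρ x)
    have hρq0 : 0 < ρ q := hρ₀.trans_le (hρ q)
    -- the times of `q`
    have hqt : (x.1 : ℝ) - (A * ρ x) ^ 2 ≤ q.1 ∧ (q.1 : ℝ) ≤ x.1 := by
      have h := (mem_pParabolicNhd_iff.1 hq).1
      exact ⟨h.1, by linarith [h.2]⟩
    -- the induction hypothesis at `q`
    have hqn : ρ q ≤ 10 ^ n * ρ₀ := by
      rw [pow_succ] at hx
      nlinarith
    have hIq : Icc ((q.1 : ℝ) - 200 * A ^ 2 * ρ q ^ 2) (q.1 : ℝ) ⊆ I := by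
      refine fun t ht ↦ hI ⟨?_, ht.2.trans hqt.2⟩
      have h1 : ρ q ^ 2 ≤ (ρ x / 10) ^ 2 := pow_le_pow_left₀ hρq0.le hρq.le 2
      have h2 : 0 ≤ A ^ 2 := sq_nonneg A
      nlinarith [ht.1, hqt.1, mul_le_mul_of_nonneg_left h1 h2]
    obtain ⟨p, hq', hp, hpq, hρp, hpmax⟩ := ih q hqn hIq
    obtain ⟨hx', -⟩ := hside x hI
    refine ⟨p, hx', hp, ?_, hρp.trans (by linarith), hpmax⟩
    -- `P*⁻(q; 10 A ρ q) ⊆ P*⁻(x; 10 A ρ x)` (Prop. 9.3 (c))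
    have h1 : 10 * A * ρ q ≤ A * ρ x := by nlinarith [mul_lt_mul_of_pos_left hρq hA]
    have h2 : (10 * A * ρ q) ^ 2 ≤ (A * ρ x) ^ 2 := pow_le_pow_left₀ (by positivity) h1 2
    have h3 : 0 < A * ρ x := mul_pos hA hρx
    have hsub : 𝒳.pParabolicNhd q (10 * A * ρ q) ((10 * A * ρ q) ^ 2) 0 hq' ⊆
        𝒳.pParabolicNhd x (10 * A * ρ x) ((10 * A * ρ x) ^ 2) 0 hx' :=
      hH.pParabolicNhd_subset_of_mem (sq_nonneg _) (sq_nonneg _) hq (by nlinarith)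
        (by nlinarith) (le_of_eq (zero_add (0 : ℝ))) hq' hx'
    exact hsub hpq

end MetricFlow

end Literature.Geometry.Riemannian

end
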